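import Summits.NavierStokesRegularity.NavierStokesRegularity.Theorems.AxisymmetricExtremalityAxisymmetricKatoGlobalStubSeregin2020TypeIILemma22Assembly
import Summits.NavierStokesRegularity.NavierStokesRegularity.Theorems.AxisymmetricExtremalityAxisymmetricKatoGlobalStubSeregin2020TypeIILemma22EnergyClassOfClassV
import HarnessLib

/-!
# Seregin 2020, Theorem 2.1 via Lemma 2.2: the assembly REDUCED to the Moser atom and the
# excision-error package

Toward the stub `stub_seregin2020TypeII` of the crux `AxisymmetricKatoGlobal` (= the named input
`Literature.Analysis.FluidPDE.Seregin2020_axisymmetricSingularPoint_typeII`, G. Seregin, Anal. Math.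
Phys. 10 (2020) Paper 46 = arXiv:2006.04140, Thm 2.1; cell pub/ns-inputs, kits/A1.md §2′,
kits/A1-assembly-hEC.md). The conditional assembly `seregin2020_typeII_of_moser_and_energyClass
(hL31) (hEC)` (…Lemma22Assembly) takes the energy class of the normalised class-`𝒱` pair as the
contract hypothesis `hEC`; seat ser-b's `energyClass_acrossAxis_of_classV_of_excisionErrors`
(…Lemma22EnergyClassOfClassV) proves exactly that class from a SUBSET of the contract's hypotheses
plus the excision-error package `hErr` (kit F3b.4 (e1)(e2)(e3) summed over the pieces of a cover,
with a modulus `ω → 0` as the total radius `ε → 0`). This file plugs the one into the other: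

* `energyClass_hEC_of_errPackage` — the contract `hEC`, byte for byte, from the error package
  stated under ALL the contract's binders (`hErrPkg`; a discharge using fewer hypotheses plugs in
  by a lambda);
* `seregin2020_typeII_of_moser_and_errPackage` — `hL31 → hErrPkg →
  Seregin2020_axisymmetricSingularPoint_typeII`.

So the named input is TWO pieces away, both with fixed texts: the registered Moser atom
`lemma22_smallSublevel_lowerBound` (`hL31`; ⇐ `lemma22_moserStep`) and the error package `hErrPkg`.
CONDITIONAL; no Navier–Stokes regularity statement is proved here — a printed theorem is being
re-proved as an INPUT, which makes the conditional lines unconditional AS TYPED once it lands.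

## References

* G. Seregin, Anal. Math. Phys. 10 (2020), Paper 46 = arXiv:2006.04140, Thm 2.1, Lemma 2.2, §3.
  [Seregin2020]
* A. I. Nazarov, N. N. Uraltseva, St. Petersburg Math. J. 23 (2012) 93–115 = arXiv:1011.1888,
  §3 (3.9), Remark 9, Lemma 4.2. [NazarovUraltseva2012]
-/

-- the problem directory repeats the summit name (D-0017); core's `dupNamespace` linter fires
set_option linter.dupNamespace false

noncomputable section

open MeasureTheory Set Function Filter Topology TopologicalSpace Metric
open scoped NNReal ENNReal InnerProductSpace RealInnerProductSpace

namespace Summit.NavierStokesRegularity.NavierStokesRegularity.Theorems.AxisymmetricKatoGlobal.EulerScaling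

open Literature.Analysis.FluidPDE Literature.Analysis.FluidPDE.Seregin2020

/-- **The L22-B contract `hEC` from the excision-error package.** For every raw class-`𝒱` datum
`(U, Φ, S, R, k, N)` and its normalised pair `(Φ', U')` (kits/A1-assembly-hEC.md): if the
excision-error package of `energyClass_acrossAxis_of_classV_of_excisionErrors` holds (hypothesis
`hErrPkg`, stated under all the contract's binders), then the registered v3 energy class of
`(Φ', U', k, R)` holds — i.e. the assembly's hypothesis `hEC`, byte for byte. A one-line plug into
seat ser-b's theorem. CONDITIONAL on `hErrPkg`.
[cite: NazarovUraltseva2012, §3 (3.9), Remark 9; Seregin2020, Lemma 2.2, §3] -/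
theorem energyClass_hEC_of_errPackage
    (hErrPkg : ∀ (U U' : ℝ → EuclideanSpace ℝ (Fin 3) → EuclideanSpace ℝ (Fin 3)) (Φ Φ' : ℝ → EuclideanSpace ℝ (Fin 3) → ℝ)
      (S : Set (ℝ × EuclideanSpace ℝ (Fin 3))) (R k : ℝ) (N : ℝ≥0),
    ContinuousOn (uncurry U) {z : ℝ × EuclideanSpace ℝ (Fin 3) | z.1 < 0 ∧ cylRadius z.2 ≠ 0} →
    (∀ z : ℝ × EuclideanSpace ℝ (Fin 3), z.1 < 0 → cylRadius z.2 ≠ 0 → ContDiffAt ℝ (⊤ : ℕ∞) (U z.1) z.2) →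
    ContinuousOn (fun z : ℝ × EuclideanSpace ℝ (Fin 3) => fderiv ℝ (U z.1) z.2) {z : ℝ × EuclideanSpace ℝ (Fin 3) | z.1 < 0 ∧ cylRadius z.2 ≠ 0} →
    (∀ z : ℝ × EuclideanSpace ℝ (Fin 3), z.1 < 0 → cylRadius z.2 ≠ 0 → VectorCalculus.divergence (U z.1) z.2 = 0) →
    (∀ a : ℝ, 0 < a → ∫⁻ z in parabolicCylinder a (0 : ℝ × EuclideanSpace ℝ (Fin 3)), ‖U z.1 z.2‖ₑ ^ (3 : ℕ) < ∞) →
    IsClosed S → (∀ z ∈ S, z.1 ≤ 0 ∧ cylRadius z.2 = 0) → IsParabolicNull 1 S →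
    ContinuousOn (uncurry Φ) ({z : ℝ × EuclideanSpace ℝ (Fin 3) | z.1 < 0} \ S) →
    (∀ z : ℝ × EuclideanSpace ℝ (Fin 3), z.1 < 0 → z ∉ S → ContDiffAt ℝ (⊤ : ℕ∞) (Φ z.1) z.2) →
    ContinuousOn (fun z : ℝ × EuclideanSpace ℝ (Fin 3) => fderiv ℝ (Φ z.1) z.2) ({z : ℝ × EuclideanSpace ℝ (Fin 3) | z.1 < 0} \ S) →
    (∀ e : EuclideanSpace ℝ (Fin 3), ContinuousOn (fun z : ℝ × EuclideanSpace ℝ (Fin 3) => fderiv ℝ (fun y => fderiv ℝ (Φ z.1) y e) z.2 e)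
      ({z : ℝ × EuclideanSpace ℝ (Fin 3) | z.1 < 0} \ S)) →
    (∀ z : ℝ × EuclideanSpace ℝ (Fin 3), z.1 < 0 → cylRadius z.2 ≠ 0 → DifferentiableAt ℝ (fun r => Φ r z.2) z.1) →
    ContinuousOn (fun z : ℝ × EuclideanSpace ℝ (Fin 3) => deriv (fun r => Φ r z.2) z.1)
      {z : ℝ × EuclideanSpace ℝ (Fin 3) | z.1 < 0 ∧ cylRadius z.2 ≠ 0} →
    (∀ δ' ρ : ℝ, 0 < δ' → δ' < ρ → ∃ C : ℝ, ∀ z : ℝ × EuclideanSpace ℝ (Fin 3),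
      z.1 ∈ Ioo (-ρ ^ 2) 0 → δ' < cylRadius z.2 → cylRadius z.2 < ρ → |z.2 2| < ρ →
        |deriv (fun r => Φ r z.2) z.1| ≤ C ∧ ‖fderiv ℝ (Φ z.1) z.2‖ ≤ C ∧
        ∀ e : EuclideanSpace ℝ (Fin 3), ‖e‖ ≤ 1 → |fderiv ℝ (fun y => fderiv ℝ (Φ z.1) y e) z.2 e| ≤ C) →
    (∃ B : ℝ, ∀ z : ℝ × EuclideanSpace ℝ (Fin 3), z.1 < 0 → z ∉ S → |Φ z.1 z.2| ≤ B) →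
    (∀ z : ℝ × EuclideanSpace ℝ (Fin 3), z.1 < 0 → z ∉ S → 0 ≤ Φ z.1 z.2) →
    (∀ z : ℝ × EuclideanSpace ℝ (Fin 3), z.1 < 0 → cylRadius z.2 ≠ 0 →
      0 ≤ deriv (fun r => Φ r z.2) z.1 + fderiv ℝ (Φ z.1) z.2 (U z.1 z.2) +
          2 / cylRadius z.2 * partialDeriv (eR z.2) (Φ z.1) z.2 - (Laplacian.laplacian (Φ z.1)) z.2) →
    0 < R → 0 < k →
    (∫⁻ s in Ioo (-R ^ 2) 0, (∫⁻ y in ball (0 : EuclideanSpace ℝ (Fin 3)) (2 * R), ‖U s y‖ₑ ^ (3 : ℕ)) ^ (4 / 3 : ℝ) ≤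
      (N : ℝ≥0∞) * ENNReal.ofReal R ^ 2) →
    (∀ z : ℝ × EuclideanSpace ℝ (Fin 3), z.1 ∈ Ioo (-R ^ 2) 0 → cylRadius z.2 = 0 →
      z.2 2 ∈ Ioo (-(2 * R)) (2 * R) → z ∉ S → k ≤ Φ z.1 z.2) →
    (∀ t x, t < 0 → (t, x) ∉ S → Φ' t x = Φ t x) → (∀ t x, ¬ (t < 0 ∧ (t, x) ∉ S) → Φ' t x = k) →
    (∀ t x, t < 0 → cylRadius x ≠ 0 → U' t x = U t x) → (∀ t x, ¬ (t < 0 ∧ cylRadius x ≠ 0) → U' t x = 0) →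
      (∀ (H : ℝ → ℝ), ContDiff ℝ 2 H → (∀ v, deriv H v ≤ 0) → (∀ v, 0 ≤ H v) → (∀ v, k ≤ v → H v = 0) →
        ∀ (Θ : EuclideanSpace ℝ (Fin 3) → ℝ), ContDiff ℝ 1 Θ → HasCompactSupport Θ →
          tsupport Θ ⊆ ball (0 : EuclideanSpace ℝ (Fin 3)) (2 * R) →
        ∀ (η : ℝ → ℝ), ContDiff ℝ 1 η → (∀ s, 0 ≤ η s) →
        ∀ (t₁ t₂ : ℝ), -R ^ 2 < t₁ → t₁ ≤ t₂ → t₂ < 0 →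
        ∃ ω : ℝ → ℝ, Tendsto ω (𝓝[>] 0) (𝓝 0) ∧
          ∀ (s : Finset ℕ) (z : ℕ → ℝ × EuclideanSpace ℝ (Fin 3)) (r : ℕ → ℝ) (ε : ℝ), 0 < ε →
            (∀ i ∈ s, 0 < r i ∧ r i < 1) → ∑ i ∈ s, r i ≤ ε →
          ∀ (p : ℕ) (τ : ℕ → ℝ), Monotone τ → τ 0 = t₁ → τ p = t₂ →
          ∀ (A : ℕ → Finset ℕ), (∀ m, A m = s.filter fun i => (z i).1 - 2 * r i ^ 2 ≤ τ m ∧ τ (m + 1) ≤ (z i).1 + 2 * r i ^ 2) →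
          ∀ (φ : ℕ → EuclideanSpace ℝ (Fin 3) → ℝ), (∀ m y, φ m y = ∏ i ∈ A m, (1 - cutoff (2 * r i) (y - (z i).2))) →
            (∀ m < p,
              Integrable (fun w : ℝ × EuclideanSpace ℝ (Fin 3) =>
                  η w.1 * (H (Φ' w.1 w.2) * (Θ w.2 ^ 2 * ‖gradient (φ m) w.2‖ ^ 2)))
                (volume.restrict (Icc (τ m) (τ (m + 1)) ×ˢ (univ : Set (EuclideanSpace ℝ (Fin 3))))) ∧
              Integrable (fun w : ℝ × EuclideanSpace ℝ (Fin 3) =>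
                  η w.1 * (H (Φ' w.1 w.2) * inner ℝ (U' w.1 w.2) ((Θ w.2 ^ 2) • gradient (fun y => φ m y ^ 2) w.2)))
                (volume.restrict (Icc (τ m) (τ (m + 1)) ×ˢ (univ : Set (EuclideanSpace ℝ (Fin 3))))) ∧
              Integrable (fun w : ℝ × EuclideanSpace ℝ (Fin 3) =>
                  η w.1 * (2 / cylRadius w.2 * (H (Φ' w.1 w.2) * (Θ w.2 ^ 2 * fderiv ℝ (fun y => φ m y ^ 2) w.2 (eR w.2)))))
                (volume.restrict (Icc (τ m) (τ (m + 1)) ×ˢ (univ : Set (EuclideanSpace ℝ (Fin 3)))))) ∧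
            (∑ m ∈ Finset.range p, ∫ w in Icc (τ m) (τ (m + 1)) ×ˢ (univ : Set (EuclideanSpace ℝ (Fin 3))),
                η w.1 * (H (Φ' w.1 w.2) * (Θ w.2 ^ 2 * ‖gradient (φ m) w.2‖ ^ 2))) ≤ ω ε ∧
            (∑ m ∈ Finset.range p, ∫ w in Icc (τ m) (τ (m + 1)) ×ˢ (univ : Set (EuclideanSpace ℝ (Fin 3))),
                η w.1 * (H (Φ' w.1 w.2) * |inner ℝ (U' w.1 w.2) ((Θ w.2 ^ 2) • gradient (fun y => φ m y ^ 2) w.2)|)) ≤ ω ε ∧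
            (∑ m ∈ Finset.range p, ∫ w in Icc (τ m) (τ (m + 1)) ×ˢ (univ : Set (EuclideanSpace ℝ (Fin 3))),
                η w.1 * (2 / cylRadius w.2 * (H (Φ' w.1 w.2) * |Θ w.2 ^ 2 * fderiv ℝ (fun y => φ m y ^ 2) w.2 (eR w.2)|))) ≤ ω ε)) :
    ∀ (U U' : ℝ → EuclideanSpace ℝ (Fin 3) → EuclideanSpace ℝ (Fin 3)) (Φ Φ' : ℝ → EuclideanSpace ℝ (Fin 3) → ℝ)
      (S : Set (ℝ × EuclideanSpace ℝ (Fin 3))) (R k : ℝ) (N : ℝ≥0),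
    ContinuousOn (uncurry U) {z : ℝ × EuclideanSpace ℝ (Fin 3) | z.1 < 0 ∧ cylRadius z.2 ≠ 0} →
    (∀ z : ℝ × EuclideanSpace ℝ (Fin 3), z.1 < 0 → cylRadius z.2 ≠ 0 → ContDiffAt ℝ (⊤ : ℕ∞) (U z.1) z.2) →
    ContinuousOn (fun z : ℝ × EuclideanSpace ℝ (Fin 3) => fderiv ℝ (U z.1) z.2) {z : ℝ × EuclideanSpace ℝ (Fin 3) | z.1 < 0 ∧ cylRadius z.2 ≠ 0} →
    (∀ z : ℝ × EuclideanSpace ℝ (Fin 3), z.1 < 0 → cylRadius z.2 ≠ 0 → VectorCalculus.divergence (U z.1) z.2 = 0) →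
    (∀ a : ℝ, 0 < a → ∫⁻ z in parabolicCylinder a (0 : ℝ × EuclideanSpace ℝ (Fin 3)), ‖U z.1 z.2‖ₑ ^ (3 : ℕ) < ∞) →
    IsClosed S → (∀ z ∈ S, z.1 ≤ 0 ∧ cylRadius z.2 = 0) → IsParabolicNull 1 S →
    ContinuousOn (uncurry Φ) ({z : ℝ × EuclideanSpace ℝ (Fin 3) | z.1 < 0} \ S) →
    (∀ z : ℝ × EuclideanSpace ℝ (Fin 3), z.1 < 0 → z ∉ S → ContDiffAt ℝ (⊤ : ℕ∞) (Φ z.1) z.2) →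
    ContinuousOn (fun z : ℝ × EuclideanSpace ℝ (Fin 3) => fderiv ℝ (Φ z.1) z.2) ({z : ℝ × EuclideanSpace ℝ (Fin 3) | z.1 < 0} \ S) →
    (∀ e : EuclideanSpace ℝ (Fin 3), ContinuousOn (fun z : ℝ × EuclideanSpace ℝ (Fin 3) => fderiv ℝ (fun y => fderiv ℝ (Φ z.1) y e) z.2 e)
      ({z : ℝ × EuclideanSpace ℝ (Fin 3) | z.1 < 0} \ S)) →
    (∀ z : ℝ × EuclideanSpace ℝ (Fin 3), z.1 < 0 → cylRadius z.2 ≠ 0 → DifferentiableAt ℝ (fun r => Φ r z.2) z.1) →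
    ContinuousOn (fun z : ℝ × EuclideanSpace ℝ (Fin 3) => deriv (fun r => Φ r z.2) z.1)
      {z : ℝ × EuclideanSpace ℝ (Fin 3) | z.1 < 0 ∧ cylRadius z.2 ≠ 0} →
    (∀ δ' ρ : ℝ, 0 < δ' → δ' < ρ → ∃ C : ℝ, ∀ z : ℝ × EuclideanSpace ℝ (Fin 3),
      z.1 ∈ Ioo (-ρ ^ 2) 0 → δ' < cylRadius z.2 → cylRadius z.2 < ρ → |z.2 2| < ρ →
        |deriv (fun r => Φ r z.2) z.1| ≤ C ∧ ‖fderiv ℝ (Φ z.1) z.2‖ ≤ C ∧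
        ∀ e : EuclideanSpace ℝ (Fin 3), ‖e‖ ≤ 1 → |fderiv ℝ (fun y => fderiv ℝ (Φ z.1) y e) z.2 e| ≤ C) →
    (∃ B : ℝ, ∀ z : ℝ × EuclideanSpace ℝ (Fin 3), z.1 < 0 → z ∉ S → |Φ z.1 z.2| ≤ B) →
    (∀ z : ℝ × EuclideanSpace ℝ (Fin 3), z.1 < 0 → z ∉ S → 0 ≤ Φ z.1 z.2) →
    (∀ z : ℝ × EuclideanSpace ℝ (Fin 3), z.1 < 0 → cylRadius z.2 ≠ 0 →
      0 ≤ deriv (fun r => Φ r z.2) z.1 + fderiv ℝ (Φ z.1) z.2 (U z.1 z.2) +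
          2 / cylRadius z.2 * partialDeriv (eR z.2) (Φ z.1) z.2 - (Laplacian.laplacian (Φ z.1)) z.2) →
    0 < R → 0 < k →
    (∫⁻ s in Ioo (-R ^ 2) 0, (∫⁻ y in ball (0 : EuclideanSpace ℝ (Fin 3)) (2 * R), ‖U s y‖ₑ ^ (3 : ℕ)) ^ (4 / 3 : ℝ) ≤
      (N : ℝ≥0∞) * ENNReal.ofReal R ^ 2) →
    (∀ z : ℝ × EuclideanSpace ℝ (Fin 3), z.1 ∈ Ioo (-R ^ 2) 0 → cylRadius z.2 = 0 →
      z.2 2 ∈ Ioo (-(2 * R)) (2 * R) → z ∉ S → k ≤ Φ z.1 z.2) →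
    (∀ t x, t < 0 → (t, x) ∉ S → Φ' t x = Φ t x) → (∀ t x, ¬ (t < 0 ∧ (t, x) ∉ S) → Φ' t x = k) →
    (∀ t x, t < 0 → cylRadius x ≠ 0 → U' t x = U t x) → (∀ t x, ¬ (t < 0 ∧ cylRadius x ≠ 0) → U' t x = 0) →
    (∀ (H : ℝ → ℝ), ContDiff ℝ 2 H → (∀ v, deriv H v ≤ 0) → (∀ v, 0 ≤ H v) → (∀ v, 0 ≤ deriv
          (deriv H) v) → (∀ v, deriv H v ^ 2 ≤ 2 * H v * deriv (deriv H) v) → (∀ v, k ≤ v → H v = 0)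
          → ∀ (Θ : EuclideanSpace ℝ (Fin 3) → ℝ), ContDiff ℝ 1 Θ → HasCompactSupport Θ → tsupport Θ
          ⊆ ball (0 : EuclideanSpace ℝ (Fin 3)) (2 * R) → ∀ (η : ℝ → ℝ), ContDiff ℝ 1 η → (∀ s, 0 ≤
          η s) → ∀ (t₁ t₂ : ℝ), -R ^ 2 < t₁ → t₁ ≤ t₂ → t₂ < 0 → ENNReal.ofReal (η t₂ * ∫ x, H (Φ' t₂
          x) * Θ x ^ 2) + ∫⁻ z in Icc t₁ t₂ ×ˢ (univ : Set (EuclideanSpace ℝ (Fin 3))),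
          ENNReal.ofReal (1 / 2 * η z.1 * (deriv (deriv H) (Φ' z.1 z.2) * ‖gradient (Φ' z.1) z.2‖ ^ 2
          * Θ z.2 ^ 2)) ≤ ENNReal.ofReal (η t₁ * (∫ x, H (Φ' t₁ x) * Θ x ^ 2) + (4 * ∫ z in Icc t₁ t₂
          ×ˢ (univ : Set (EuclideanSpace ℝ (Fin 3))), η z.1 * (H (Φ' z.1 z.2) * ‖gradient Θ z.2‖ ^
          2)) + (∫ z in Icc t₁ t₂ ×ˢ (univ : Set (EuclideanSpace ℝ (Fin 3))), η z.1 * (H (Φ' z.1 z.2)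
          * inner ℝ (U' z.1 z.2) (gradient (fun y => Θ y ^ 2) z.2))) + (∫ z in Icc t₁ t₂ ×ˢ (univ :
          Set (EuclideanSpace ℝ (Fin 3))), η z.1 * (2 / cylRadius z.2 * (H (Φ' z.1 z.2) * fderiv ℝ
          (fun y => Θ y ^ 2) z.2 (eR z.2)))) + (∫ z in Icc t₁ t₂ ×ˢ (univ : Set (EuclideanSpace ℝ
          (Fin 3))), |deriv η z.1| * (H (Φ' z.1 z.2) * Θ z.2 ^ 2)))) :=
  fun U U' Φ Φ' S R k N hUc hUs hUg hdiv hU3 hSc hSax hSP hΦc hΦs hΦg hΦgg hΦt hΦt' hbd hB hΦ0 hsup hR hk hN hkax hΦ'1 hΦ'2 hU'1 hU'2 =>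
    energyClass_acrossAxis_of_classV_of_excisionErrors hUc hUs hdiv hU3 hSc hSax hSP hΦc hΦs hΦg hΦt hΦt'
      hΦ0 hsup hR hk hkax hΦ'1 hΦ'2 hU'1 hU'2
      (hErrPkg U U' Φ Φ' S R k N hUc hUs hUg hdiv hU3 hSc hSax hSP hΦc hΦs hΦg hΦgg hΦt hΦt' hbd hB hΦ0 hsup hR hk hN hkax hΦ'1 hΦ'2 hU'1 hU'2)

/-- **Seregin 2020, Theorem 2.1 from the Moser atom and the excision-error package**: the named
input `Seregin2020_axisymmetricSingularPoint_typeII` follows from the registered atom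
`lemma22_smallSublevel_lowerBound` (hypothesis `hL31`, verbatim) and the excision-error package
(`hErrPkg`), by `seregin2020_typeII_of_moser_and_energyClass` and `energyClass_hEC_of_errPackage`.
CONDITIONAL on `hL31`, `hErrPkg`; no NS regularity statement is proved.
[cite: Seregin2020, Thm 2.1, Lemma 2.2; NazarovUraltseva2012, Lemma 3.1, Cor 3.3, Lemma 4.2] -/
theorem seregin2020_typeII_of_moser_and_errPackage
    (hL31 : ∀ (lamlo θlo θhi : ℝ) (N : ℝ≥0), 1 < lamlo → lamlo ≤ 2 → 0 < θlo → θlo ≤ θhi →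
      ∃ μ₁ : ℝ, 0 < μ₁ ∧
      ∀ (Φ : ℝ → EuclideanSpace ℝ (Fin 3) → ℝ) (U : ℝ → EuclideanSpace ℝ (Fin 3) → EuclideanSpace ℝ (Fin 3))
        (S : Set (ℝ × EuclideanSpace ℝ (Fin 3))) (k R : ℝ), (0 < k ∧ 0 < R ∧ Measurable (uncurry Φ) ∧ AEStronglyMeasurable (uncurry U) volume ∧
          IsClosed S ∧ (∀ z ∈ S, cylRadius z.2 = 0) ∧ ContinuousOn (uncurry Φ) ({z : ℝ ×
          EuclideanSpace ℝ (Fin 3) | z.1 < 0} \ S) ∧ (∀ t x, 0 ≤ Φ t x) ∧ (∀ᵐ t : ℝ, t ∈ Ioo (-R ^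
          2) 0 → ContDiff ℝ 1 (Φ t)) ∧ (∫⁻ s in Ioo (-R ^ 2) 0, (∫⁻ y in ball (0 : EuclideanSpace ℝ
          (Fin 3)) (2 * R), ‖U s y‖ₑ ^ (3 : ℕ)) ^ (4 / 3 : ℝ) ≤ (N : ℝ≥0∞) * ENNReal.ofReal R ^ 2) ∧
          (∀ (H : ℝ → ℝ), ContDiff ℝ 2 H → (∀ v, deriv H v ≤ 0) → (∀ v, 0 ≤ H v) → (∀ v, 0 ≤ deriv
          (deriv H) v) → (∀ v, deriv H v ^ 2 ≤ 2 * H v * deriv (deriv H) v) → (∀ v, k ≤ v → H v = 0)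
          → ∀ (Θ : EuclideanSpace ℝ (Fin 3) → ℝ), ContDiff ℝ 1 Θ → HasCompactSupport Θ → tsupport Θ
          ⊆ ball (0 : EuclideanSpace ℝ (Fin 3)) (2 * R) → ∀ (η : ℝ → ℝ), ContDiff ℝ 1 η → (∀ s, 0 ≤
          η s) → ∀ (t₁ t₂ : ℝ), -R ^ 2 < t₁ → t₁ ≤ t₂ → t₂ < 0 → ENNReal.ofReal (η t₂ * ∫ x, H (Φ t₂
          x) * Θ x ^ 2) + ∫⁻ z in Icc t₁ t₂ ×ˢ (univ : Set (EuclideanSpace ℝ (Fin 3))),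
          ENNReal.ofReal (1 / 2 * η z.1 * (deriv (deriv H) (Φ z.1 z.2) * ‖gradient (Φ z.1) z.2‖ ^ 2
          * Θ z.2 ^ 2)) ≤ ENNReal.ofReal (η t₁ * (∫ x, H (Φ t₁ x) * Θ x ^ 2) + (4 * ∫ z in Icc t₁ t₂
          ×ˢ (univ : Set (EuclideanSpace ℝ (Fin 3))), η z.1 * (H (Φ z.1 z.2) * ‖gradient Θ z.2‖ ^
          2)) + (∫ z in Icc t₁ t₂ ×ˢ (univ : Set (EuclideanSpace ℝ (Fin 3))), η z.1 * (H (Φ z.1 z.2)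
          * inner ℝ (U z.1 z.2) (gradient (fun y => Θ y ^ 2) z.2))) + (∫ z in Icc t₁ t₂ ×ˢ (univ :
          Set (EuclideanSpace ℝ (Fin 3))), η z.1 * (2 / cylRadius z.2 * (H (Φ z.1 z.2) * fderiv ℝ
          (fun y => Θ y ^ 2) z.2 (eR z.2)))) + (∫ z in Icc t₁ t₂ ×ˢ (univ : Set (EuclideanSpace ℝ
          (Fin 3))), |deriv η z.1| * (H (Φ z.1 z.2) * Θ z.2 ^ 2))))) →
      ∀ (lam ρ θ t₀ l : ℝ), lamlo ≤ lam → lam ≤ 2 → R / 4 ≤ ρ → lam * ρ ≤ 2 * R → θlo ≤ θ → θ ≤ θhi →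
        t₀ ≤ 0 → -R ^ 2 < t₀ - θ * ρ ^ 2 → 0 < l → l ≤ k →
        volume {z : ℝ × EuclideanSpace ℝ (Fin 3) |
            z ∈ Ioo (t₀ - θ * ρ ^ 2) t₀ ×ˢ ball (0 : EuclideanSpace ℝ (Fin 3)) (lam * ρ) ∧ Φ z.1 z.2 < l}
          ≤ ENNReal.ofReal μ₁ * volume (Ioo (t₀ - θ * ρ ^ 2) t₀ ×ˢ ball (0 : EuclideanSpace ℝ (Fin 3)) (lam * ρ)) →
        (∀ᵐ z ∂(volume.restrict (Ioo (t₀ - θ / 2 * ρ ^ 2) t₀ ×ˢ ball (0 : EuclideanSpace ℝ (Fin 3)) ρ)),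
            l / 2 ≤ Φ z.1 z.2) ∧
        ((∀ᵐ x ∂(volume.restrict (ball (0 : EuclideanSpace ℝ (Fin 3)) (lam * ρ))), l ≤ Φ (t₀ - θ * ρ ^ 2) x) →
          ∀ᵐ z ∂(volume.restrict (Ioo (t₀ - θ * ρ ^ 2) t₀ ×ˢ ball (0 : EuclideanSpace ℝ (Fin 3)) ρ)),
            l / 2 ≤ Φ z.1 z.2))
    (hErrPkg : ∀ (U U' : ℝ → EuclideanSpace ℝ (Fin 3) → EuclideanSpace ℝ (Fin 3)) (Φ Φ' : ℝ → EuclideanSpace ℝ (Fin 3) → ℝ)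
      (S : Set (ℝ × EuclideanSpace ℝ (Fin 3))) (R k : ℝ) (N : ℝ≥0),
    ContinuousOn (uncurry U) {z : ℝ × EuclideanSpace ℝ (Fin 3) | z.1 < 0 ∧ cylRadius z.2 ≠ 0} →
    (∀ z : ℝ × EuclideanSpace ℝ (Fin 3), z.1 < 0 → cylRadius z.2 ≠ 0 → ContDiffAt ℝ (⊤ : ℕ∞) (U z.1) z.2) →
    ContinuousOn (fun z : ℝ × EuclideanSpace ℝ (Fin 3) => fderiv ℝ (U z.1) z.2) {z : ℝ × EuclideanSpace ℝ (Fin 3) | z.1 < 0 ∧ cylRadius z.2 ≠ 0} →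
    (∀ z : ℝ × EuclideanSpace ℝ (Fin 3), z.1 < 0 → cylRadius z.2 ≠ 0 → VectorCalculus.divergence (U z.1) z.2 = 0) →
    (∀ a : ℝ, 0 < a → ∫⁻ z in parabolicCylinder a (0 : ℝ × EuclideanSpace ℝ (Fin 3)), ‖U z.1 z.2‖ₑ ^ (3 : ℕ) < ∞) →
    IsClosed S → (∀ z ∈ S, z.1 ≤ 0 ∧ cylRadius z.2 = 0) → IsParabolicNull 1 S →
    ContinuousOn (uncurry Φ) ({z : ℝ × EuclideanSpace ℝ (Fin 3) | z.1 < 0} \ S) →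
    (∀ z : ℝ × EuclideanSpace ℝ (Fin 3), z.1 < 0 → z ∉ S → ContDiffAt ℝ (⊤ : ℕ∞) (Φ z.1) z.2) →
    ContinuousOn (fun z : ℝ × EuclideanSpace ℝ (Fin 3) => fderiv ℝ (Φ z.1) z.2) ({z : ℝ × EuclideanSpace ℝ (Fin 3) | z.1 < 0} \ S) →
    (∀ e : EuclideanSpace ℝ (Fin 3), ContinuousOn (fun z : ℝ × EuclideanSpace ℝ (Fin 3) => fderiv ℝ (fun y => fderiv ℝ (Φ z.1) y e) z.2 e)
      ({z : ℝ × EuclideanSpace ℝ (Fin 3) | z.1 < 0} \ S)) →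
    (∀ z : ℝ × EuclideanSpace ℝ (Fin 3), z.1 < 0 → cylRadius z.2 ≠ 0 → DifferentiableAt ℝ (fun r => Φ r z.2) z.1) →
    ContinuousOn (fun z : ℝ × EuclideanSpace ℝ (Fin 3) => deriv (fun r => Φ r z.2) z.1)
      {z : ℝ × EuclideanSpace ℝ (Fin 3) | z.1 < 0 ∧ cylRadius z.2 ≠ 0} →
    (∀ δ' ρ : ℝ, 0 < δ' → δ' < ρ → ∃ C : ℝ, ∀ z : ℝ × EuclideanSpace ℝ (Fin 3),
      z.1 ∈ Ioo (-ρ ^ 2) 0 → δ' < cylRadius z.2 → cylRadius z.2 < ρ → |z.2 2| < ρ →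
        |deriv (fun r => Φ r z.2) z.1| ≤ C ∧ ‖fderiv ℝ (Φ z.1) z.2‖ ≤ C ∧
        ∀ e : EuclideanSpace ℝ (Fin 3), ‖e‖ ≤ 1 → |fderiv ℝ (fun y => fderiv ℝ (Φ z.1) y e) z.2 e| ≤ C) →
    (∃ B : ℝ, ∀ z : ℝ × EuclideanSpace ℝ (Fin 3), z.1 < 0 → z ∉ S → |Φ z.1 z.2| ≤ B) →
    (∀ z : ℝ × EuclideanSpace ℝ (Fin 3), z.1 < 0 → z ∉ S → 0 ≤ Φ z.1 z.2) →
    (∀ z : ℝ × EuclideanSpace ℝ (Fin 3), z.1 < 0 → cylRadius z.2 ≠ 0 →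
      0 ≤ deriv (fun r => Φ r z.2) z.1 + fderiv ℝ (Φ z.1) z.2 (U z.1 z.2) +
          2 / cylRadius z.2 * partialDeriv (eR z.2) (Φ z.1) z.2 - (Laplacian.laplacian (Φ z.1)) z.2) →
    0 < R → 0 < k →
    (∫⁻ s in Ioo (-R ^ 2) 0, (∫⁻ y in ball (0 : EuclideanSpace ℝ (Fin 3)) (2 * R), ‖U s y‖ₑ ^ (3 : ℕ)) ^ (4 / 3 : ℝ) ≤
      (N : ℝ≥0∞) * ENNReal.ofReal R ^ 2) →
    (∀ z : ℝ × EuclideanSpace ℝ (Fin 3), z.1 ∈ Ioo (-R ^ 2) 0 → cylRadius z.2 = 0 →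
      z.2 2 ∈ Ioo (-(2 * R)) (2 * R) → z ∉ S → k ≤ Φ z.1 z.2) →
    (∀ t x, t < 0 → (t, x) ∉ S → Φ' t x = Φ t x) → (∀ t x, ¬ (t < 0 ∧ (t, x) ∉ S) → Φ' t x = k) →
    (∀ t x, t < 0 → cylRadius x ≠ 0 → U' t x = U t x) → (∀ t x, ¬ (t < 0 ∧ cylRadius x ≠ 0) → U' t x = 0) →
      (∀ (H : ℝ → ℝ), ContDiff ℝ 2 H → (∀ v, deriv H v ≤ 0) → (∀ v, 0 ≤ H v) → (∀ v, k ≤ v → H v = 0) →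
        ∀ (Θ : EuclideanSpace ℝ (Fin 3) → ℝ), ContDiff ℝ 1 Θ → HasCompactSupport Θ →
          tsupport Θ ⊆ ball (0 : EuclideanSpace ℝ (Fin 3)) (2 * R) →
        ∀ (η : ℝ → ℝ), ContDiff ℝ 1 η → (∀ s, 0 ≤ η s) →
        ∀ (t₁ t₂ : ℝ), -R ^ 2 < t₁ → t₁ ≤ t₂ → t₂ < 0 →
        ∃ ω : ℝ → ℝ, Tendsto ω (𝓝[>] 0) (𝓝 0) ∧
          ∀ (s : Finset ℕ) (z : ℕ → ℝ × EuclideanSpace ℝ (Fin 3)) (r : ℕ → ℝ) (ε : ℝ), 0 < ε →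
            (∀ i ∈ s, 0 < r i ∧ r i < 1) → ∑ i ∈ s, r i ≤ ε →
          ∀ (p : ℕ) (τ : ℕ → ℝ), Monotone τ → τ 0 = t₁ → τ p = t₂ →
          ∀ (A : ℕ → Finset ℕ), (∀ m, A m = s.filter fun i => (z i).1 - 2 * r i ^ 2 ≤ τ m ∧ τ (m + 1) ≤ (z i).1 + 2 * r i ^ 2) →
          ∀ (φ : ℕ → EuclideanSpace ℝ (Fin 3) → ℝ), (∀ m y, φ m y = ∏ i ∈ A m, (1 - cutoff (2 * r i) (y - (z i).2))) →
            (∀ m < p,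
              Integrable (fun w : ℝ × EuclideanSpace ℝ (Fin 3) =>
                  η w.1 * (H (Φ' w.1 w.2) * (Θ w.2 ^ 2 * ‖gradient (φ m) w.2‖ ^ 2)))
                (volume.restrict (Icc (τ m) (τ (m + 1)) ×ˢ (univ : Set (EuclideanSpace ℝ (Fin 3))))) ∧
              Integrable (fun w : ℝ × EuclideanSpace ℝ (Fin 3) =>
                  η w.1 * (H (Φ' w.1 w.2) * inner ℝ (U' w.1 w.2) ((Θ w.2 ^ 2) • gradient (fun y => φ m y ^ 2) w.2)))
                (volume.restrict (Icc (τ m) (τ (m + 1)) ×ˢ (univ : Set (EuclideanSpace ℝ (Fin 3))))) ∧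
              Integrable (fun w : ℝ × EuclideanSpace ℝ (Fin 3) =>
                  η w.1 * (2 / cylRadius w.2 * (H (Φ' w.1 w.2) * (Θ w.2 ^ 2 * fderiv ℝ (fun y => φ m y ^ 2) w.2 (eR w.2)))))
                (volume.restrict (Icc (τ m) (τ (m + 1)) ×ˢ (univ : Set (EuclideanSpace ℝ (Fin 3)))))) ∧
            (∑ m ∈ Finset.range p, ∫ w in Icc (τ m) (τ (m + 1)) ×ˢ (univ : Set (EuclideanSpace ℝ (Fin 3))),
                η w.1 * (H (Φ' w.1 w.2) * (Θ w.2 ^ 2 * ‖gradient (φ m) w.2‖ ^ 2))) ≤ ω ε ∧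
            (∑ m ∈ Finset.range p, ∫ w in Icc (τ m) (τ (m + 1)) ×ˢ (univ : Set (EuclideanSpace ℝ (Fin 3))),
                η w.1 * (H (Φ' w.1 w.2) * |inner ℝ (U' w.1 w.2) ((Θ w.2 ^ 2) • gradient (fun y => φ m y ^ 2) w.2)|)) ≤ ω ε ∧
            (∑ m ∈ Finset.range p, ∫ w in Icc (τ m) (τ (m + 1)) ×ˢ (univ : Set (EuclideanSpace ℝ (Fin 3))),
                η w.1 * (2 / cylRadius w.2 * (H (Φ' w.1 w.2) * |Θ w.2 ^ 2 * fderiv ℝ (fun y => φ m y ^ 2) w.2 (eR w.2)|))) ≤ ω ε)) :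
    Seregin2020_axisymmetricSingularPoint_typeII :=
  seregin2020_typeII_of_moser_and_energyClass hL31 (energyClass_hEC_of_errPackage hErrPkg)

end Summit.NavierStokesRegularity.NavierStokesRegularity.Theorems.AxisymmetricKatoGlobal.EulerScaling

end
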